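import Literature.NumberTheory.EllipticCurves.PAdicLFunctionNeZeroProofs
import HarnessLib

/-!
# `Γ₁(N)`-equivalence of cusps: Diamond–Shurman, Prop. 3.8.3 (the `+` sign), constructive

Two cusps `a/c`, `a'/c'` of `ℙ¹(ℚ)` written in lowest terms (`(a, c)`, `(a', c')` primitive) with
`c' ≡ c (mod N)` and `a' ≡ a (mod gcd(c, N))` are `Γ₁(N)`-equivalent: some `γ ∈ Γ₁(N)` carries the column
vector `(a, c)ᵀ` to `(a', c')ᵀ`, hence (for `c, c' ≠ 0`) the point `a/c ∈ ℚ` to `a'/c'` under the Möbius action.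
PROOF (the printed one): `a' ≡ a (mod gcd(c, N))` gives `a' = a + jc + kN`; the translation `T^j = (1 j; 0 1) ∈ Γ₁(N)`
moves `(a, c)ᵀ` to `(a + jc, c)ᵀ ≡ (a', c')ᵀ (mod N)`, and two primitive vectors congruent mod `N` differ by an
element of `Γ(N) ≤ Γ₁(N)` (Lemma 3.8.2, in the tree as `exists_mem_Gamma_vec_eq`).
This is the move lemma `Gamma1CuspMove` asked for by cell bsd-f2-manin (es g63 MEMO-es §92.4, typed verbatim in
`Sketch-es-g63.lean`); it is a lemma about `SL(2, ℤ)` only — no modular forms, no elliptic curves, nothing about BSD.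
[cite: DiamondShurman2005, Prop. 3.8.3 (PDF p. 120) and Lemma 3.8.2 (PDF p. 119)]
-/

set_option autoImplicit false

namespace Literature.NumberTheory.EllipticCurves

open scoped MatrixGroups
open CongruenceSubgroup Matrix

/-- The translation `T^j = (1 j; 0 1)` (`ModularGroup.T ^ j`) lies in `Γ₁(N)`. [cite: DiamondShurman2005, §1.2 (PDF p. 27)] -/
theorem T_zpow_mem_Gamma1 (N : ℕ) (j : ℤ) : ModularGroup.T ^ j ∈ Gamma1 N := by
  rw [Gamma1_mem]
  have h := ModularGroup.coe_T_zpow j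
  have h00 : (↑(ModularGroup.T ^ j) : Matrix (Fin 2) (Fin 2) ℤ) 0 0 = 1 := by rw [h]; rfl
  have h11 : (↑(ModularGroup.T ^ j) : Matrix (Fin 2) (Fin 2) ℤ) 1 1 = 1 := by rw [h]; rfl
  have h10 : (↑(ModularGroup.T ^ j) : Matrix (Fin 2) (Fin 2) ℤ) 1 0 = 0 := by rw [h]; rfl
  refine ⟨?_, ?_, ?_⟩
  · exact_mod_cast congrArg (Int.cast : ℤ → ZMod N) h00 |>.trans Int.cast_one
  · exact_mod_cast congrArg (Int.cast : ℤ → ZMod N) h11 |>.trans Int.cast_one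
  · exact_mod_cast congrArg (Int.cast : ℤ → ZMod N) h10 |>.trans Int.cast_zero

/-- `Γ(N) ≤ Γ₁(N)`. [cite: DiamondShurman2005, §1.2 (PDF p. 27)] -/
theorem mem_Gamma1_of_mem_Gamma (N : ℕ) {γ : SL(2, ℤ)} (h : γ ∈ Gamma N) : γ ∈ Gamma1 N := by
  rw [Gamma_mem] at h; rw [Gamma1_mem]; exact ⟨h.1, h.2.2.2, h.2.2.1⟩

/-- **Diamond–Shurman, Prop. 3.8.3 (`+` sign), vector form**: primitive `(a, c)`, `(a', c')` with `c' ≡ c (mod N)` and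
`a' ≡ a (mod gcd(c, N))` differ by a matrix of `Γ₁(N)`: `γ (a, c)ᵀ = (a', c')ᵀ`.
[cite: DiamondShurman2005, Prop. 3.8.3 (PDF p. 120)] -/
theorem exists_mem_Gamma1_vec_eq {N : ℕ} {a c a' c' : ℤ} (hac : IsCoprime a c) (hac' : IsCoprime a' c')
    (hc : (c' : ZMod N) = c) (ha : (a' : ZMod (Int.gcd c N)) = a) :
    ∃ γ : SL(2, ℤ), γ ∈ Gamma1 N ∧
      (γ 0 0 : ℤ) * a + (γ 0 1 : ℤ) * c = a' ∧ (γ 1 0 : ℤ) * a + (γ 1 1 : ℤ) * c = c' := by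
  -- `a' - a = m · gcd(c, N) = (m x) c + (m y) N`
  have hdvd : ((Int.gcd c N : ℕ) : ℤ) ∣ a' - a := (ZMod.intCast_eq_intCast_iff_dvd_sub a a' _).mp ha.symm
  obtain ⟨m, hm⟩ := hdvd
  have hg : ((Int.gcd c N : ℕ) : ℤ) = c * Int.gcdA c N + (N : ℤ) * Int.gcdB c N := Int.gcd_eq_gcd_ab c N
  set j : ℤ := m * Int.gcdA c N with hj
  set k : ℤ := m * Int.gcdB c N with hk
  have ha' : a' = a + j * c + k * N := by
    have : a' - a = m * (c * Int.gcdA c N + (N : ℤ) * Int.gcdB c N) := by rw [← hg]; linarith [hm]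
    linear_combination this
  -- the shifted vector `(a + jc, c)` is primitive and congruent to `(a', c')` mod `N`
  have hac'' : IsCoprime (a + j * c) c := by
    obtain ⟨u, v, huv⟩ := hac
    exact ⟨u, v - u * j, by linear_combination huv⟩
  have haN : (a' : ZMod N) = ((a + j * c : ℤ) : ZMod N) := by
    rw [ha']; push_cast; simp
  obtain ⟨γ', hγ', h0, h1⟩ := exists_mem_Gamma_vec_eq (N := N) hac'' hac' haN hc
  -- `γ = γ' · T^j`
  have hT := ModularGroup.coe_T_zpow j
  have t00 : (↑(ModularGroup.T ^ j) : Matrix (Fin 2) (Fin 2) ℤ) 0 0 = 1 := by rw [hT]; rfl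
  have t01 : (↑(ModularGroup.T ^ j) : Matrix (Fin 2) (Fin 2) ℤ) 0 1 = j := by rw [hT]; rfl
  have t10 : (↑(ModularGroup.T ^ j) : Matrix (Fin 2) (Fin 2) ℤ) 1 0 = 0 := by rw [hT]; rfl
  have t11 : (↑(ModularGroup.T ^ j) : Matrix (Fin 2) (Fin 2) ℤ) 1 1 = 1 := by rw [hT]; rfl
  refine ⟨γ' * ModularGroup.T ^ j, Subgroup.mul_mem _ (mem_Gamma1_of_mem_Gamma N hγ') (T_zpow_mem_Gamma1 N j), ?_, ?_⟩
  · simp only [Matrix.SpecialLinearGroup.coe_mul, Matrix.mul_apply, Fin.sum_univ_two, t00, t01, t10, t11]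
    linear_combination h0
  · simp only [Matrix.SpecialLinearGroup.coe_mul, Matrix.mul_apply, Fin.sum_univ_two, t00, t01, t10, t11]
    linear_combination h1

/-- **Diamond–Shurman, Prop. 3.8.3 (`+` sign), cusp form** — exactly the statement `Gamma1CuspMove` typed by
cell bsd-f2-manin (es g63): for primitive `(a, c)`, `(a', c')` with `c, c' ≠ 0`, `c' ≡ c (mod N)`, `a' ≡ a (mod gcd(c, N))`
there is `γ ∈ Γ₁(N)` with `γ(a/c) ≠ ∞` and `γ(a/c) = a'/c'` (Möbius action on `ℚ`).
[cite: DiamondShurman2005, Prop. 3.8.3 (PDF p. 120)] -/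
theorem exists_mem_Gamma1_moebius_eq (N : ℕ) [NeZero N] (a c a' c' : ℤ) (hc0 : c ≠ 0) (hc0' : c' ≠ 0)
    (hac : IsCoprime a c) (hac' : IsCoprime a' c') (hc : (c' : ZMod N) = (c : ZMod N))
    (ha : (a' : ZMod (Int.gcd c N)) = (a : ZMod (Int.gcd c N))) :
    ∃ γ : SL(2, ℤ), γ ∈ Gamma1 N ∧ ((γ 1 0 : ℚ) * ((a : ℚ) / c) + (γ 1 1 : ℚ)) ≠ 0 ∧
      ((γ 0 0 : ℚ) * ((a : ℚ) / c) + (γ 0 1 : ℚ)) / ((γ 1 0 : ℚ) * ((a : ℚ) / c) + (γ 1 1 : ℚ)) = (a' : ℚ) / c' := by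
  obtain ⟨γ, hγ, h0, h1⟩ := exists_mem_Gamma1_vec_eq hac hac' hc ha
  have hcQ : (c : ℚ) ≠ 0 := by exact_mod_cast hc0
  have hcQ' : (c' : ℚ) ≠ 0 := by exact_mod_cast hc0'
  have h0Q : (γ 0 0 : ℚ) * a + (γ 0 1 : ℚ) * c = a' := by exact_mod_cast h0
  have h1Q : (γ 1 0 : ℚ) * a + (γ 1 1 : ℚ) * c = c' := by exact_mod_cast h1
  have hden : (γ 1 0 : ℚ) * ((a : ℚ) / c) + (γ 1 1 : ℚ) = (c' : ℚ) / c := by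
    field_simp; linear_combination h1Q
  have hnum : (γ 0 0 : ℚ) * ((a : ℚ) / c) + (γ 0 1 : ℚ) = (a' : ℚ) / c := by
    field_simp; linear_combination h0Q
  refine ⟨γ, hγ, ?_, ?_⟩
  · rw [hden]; exact div_ne_zero hcQ' hcQ
  · rw [hden, hnum]; field_simp

/-- The universally quantified package (verbatim the body of es g63's `Gamma1CuspMove`). [cite: DiamondShurman2005, Prop. 3.8.3 (PDF p. 120)] -/
theorem gamma1CuspMove :
    ∀ (N : ℕ) [NeZero N] (a c a' c' : ℤ), c ≠ 0 → c' ≠ 0 → IsCoprime a c → IsCoprime a' c' →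
      (c' : ZMod N) = (c : ZMod N) → ((a' : ZMod (Int.gcd c N)) = (a : ZMod (Int.gcd c N))) →
        ∃ γ : SL(2, ℤ), γ ∈ Gamma1 N ∧ ((γ 1 0 : ℚ) * ((a : ℚ) / c) + (γ 1 1 : ℚ)) ≠ 0 ∧
          ((γ 0 0 : ℚ) * ((a : ℚ) / c) + (γ 0 1 : ℚ)) / ((γ 1 0 : ℚ) * ((a : ℚ) / c) + (γ 1 1 : ℚ)) = (a' : ℚ) / c' :=
  fun N _ a c a' c' hc0 hc0' hac hac' hc ha ↦ exists_mem_Gamma1_moebius_eq N a c a' c' hc0 hc0' hac hac' hc ha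

end Literature.NumberTheory.EllipticCurves
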